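import Summits.AtomisticToContinuum.BoseEinsteinCondensation.Theorems.BECGroundStateSOSPeriodicIRBoundTwoSectorDefs
import Summits.AtomisticToContinuum.BoseEinsteinCondensation.Theorems.BECGroundStateSOSPeriodicIRBoundDefs
import HarnessLib

/-!
# Route `BECGroundStateSOS`, crux `PeriodicIRBound` (stmt-AtomisticToContinuum-3972), line `two-sector-gd-transfer` —
# v7 "floating thresholds": vocabulary and registered stub statements of the reshaped skeleton

Second `Defs` module of the line (sequel of `…TwoSectorDefs.lean`, p137770), written by lead seat c22
(`Cruxes/PeriodicIRBound/PICKED.md`). The v1–v6 skeleton rests on the POOLED PAIR stmt-12620 `GaussianDomination` (S1) ∧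
stmt-9094 `EnergyConvexityWindow` (S2): the Kato step turns GD into the regularised channel susceptibilities `SuscPlus` /
`SuscMinus`, whose thresholds are PINNED at the sector ground energies `E₀(N+1)` (particle channel, pair `(N, N+1)`) and
`E₀(N−1)` (hole channel, pair `(N−1, N)`); the energy combination of the KLS moment inequality is then
`E₀(N)(2n_k+1) − E₀(N−1)n_k − E₀(N+1)(n_k+1) = n_k·(−Δ²_N E₀) − (E₀(N+1) − E₀(N))`, and midpoint near-convexity (S2) is
exactly what bounds it by `n_k·ε√(ρa)/L`.

**The reshape.** Measure the two channels against FLOATING thresholds `T₊ = E₀(N) + μ₊`, `T₋ = E₀(N) − μ₋` with a common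
chemical potential up to the convexity slack, `0 ≤ μ₊`, `μ₋ ≤ μ₊ + ε√(ρa)/L`: the combination becomes
`(μ₋ − μ₊)n_k − μ₊ ≤ ε√(ρa)/L · n_k` and the landed endgame (`WindowArith.energyComb_le` with `e3 := e0 + μ₊`,
`e1 := e0 − μ₋`; `kls_endgame`; `WindowArith.half_le`) runs verbatim — no convexity anywhere. Two remarks fix the shape:

* the floating version must be stated on the KLS TEST VECTORS `a†(φ_n)ψ`, `a(φ_n)ψ` of a near-minimiser `ψ` (which is all
  the landed S4 proof `KLS.klsMomentFor` uses: its blocks `hchanP`, `hchanM`), not as all-`Φ` regularised susceptibilities: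
  in `SuscPlus v N L n b`-shape statements the right side `b((1+η)(E(Φ) − T) + η)` must stay nonnegative for EVERY
  finite-energy `Φ`, and `Φ :=` a near-ground state of `H_{N±1}` forces `T₊ ≤ E₀(N+1)`, `T₋ ≤ E₀(N−1)`, i.e. midpoint
  convexity again — stmt-12620 as typed can only be combined with stmt-9094-type information;
* on the test vectors the thresholds CAN float: at fixed `(N, L)` a `δ`-near-minimiser concentrates, as `δ → 0`, on the
  momentum-`0` ground state (uniform zero-momentum gap `E_q ≥ kyFanTwo/2 > E₀`, `…ZeroMomentumGapIntegrable`), whose images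
  under `a†(φ_n)` / `a(φ_n)` carry total momentum `±2πn/L` exactly, so `T₊ < E_k(N+1)` and `T₋ < E_{−k}(N−1)` (the
  momentum-`±k` yrast energies, `≈ E₀(N±1) + c|k|` at Bogoliubov level) remain admissible; a pair `(μ₊, μ₋)` exists as soon
  as `−Δ²_N E₀ < gap_k(N+1) + gap_k(N−1) + ε√(ρa)/L` — a concavity defect up to the sum of the two phonon gaps is
  tolerated, where stmt-9094 tolerates `o(√(ρa)/L)` pointwise in `N`.

Contents: §1 the channel inequalities `ChanPlus` / `ChanMinus` (threshold and bound as real parameters) and the per-potential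
floating two-channel bound `FloatingFor v K ρ₀ C`; §2 the statements of the v7 stubs — S1' `FloatingTwoChannel` (POOLED-NEW,
open-problem strength: it implies the integrable half of the crux, hence torus TL-BEC for integrable `v` by
`…DifficultyFloorR2`), S4' `KLSNearMinimiserT` (KLS moment inequality with free thresholds), S5' `WindowAssemblyT`, S8
`PooledToFloating` (the bridge from the v6 inputs: `TwoChannelSusceptibility ∧ ConvexityFor ⇒ FloatingFor`); §3 sorry-free
glue: `chanPlus_antitone` / `chanMinus_antitone` (lower thresholds are weaker), the compositions `integrableHalf_of_floating`
(S1' ∧ S4' ∧ S5' ⇒ integrable half) and `floatingTwoChannel_of_pooled` (12620 ∧ 9094 ∧ Kato ∧ S8 ⇒ S1'), so that the v6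
revival path survives as a corollary. Statements of a proof plan, not results in print (shape after Kennedy–Lieb–Shastry,
J. Stat. Phys. 53 (1988) 1019, (12)–(14), with the chemical potential of the grand-canonical Bogoliubov functional,
LSSY2005 App. A, floating between the canonical sectors).
-/

noncomputable section

open scoped BigOperators ENNReal ComplexConjugate
open Filter MeasureTheory

namespace Summit.AtomisticToContinuum.BoseEinsteinCondensation.Cruxes.PeriodicIRBound.TwoSectorGdTransfer

open Literature.MathematicalPhysics.QuantumManyBody.BoseGas
open Summit.AtomisticToContinuum.BoseEinsteinCondensation.Theses.BECGroundStateSOS (PeriodicIRBound)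
open Summit.AtomisticToContinuum.BoseEinsteinCondensation.Theses.BECTwoSectorGD (GaussianDomination)
open Summit.AtomisticToContinuum.BoseEinsteinCondensation.Theses.BECSectorPoincareTwoScale (EnergyConvexityWindow)
open Summit.AtomisticToContinuum.BoseEinsteinCondensation.Theorems.PeriodicIRBound.Negative
  (IRBoundFor periodicIRBound_iff_split)
open Summit.AtomisticToContinuum.BoseEinsteinCondensation.Cruxes.PeriodicIRBound.LinearPhFloorWagner (WF.qform)

/-! ## §1 The KLS channel inequalities with free thresholds, and the floating two-channel bound -/

/-- **Particle channel (`+`) KLS inequality at near-minimisers of `H_{m+2}`, threshold `T`, bound `b`**: for every `η > 0`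
there is a slack `δ > 0` such that every `δ`-near-minimiser `Ψ` obeys, with `a† = a†(φ_n)`, `n_k = n_Ψ(φ_n)`,
`‖a†ψ‖² = n_k + 1` and `𝓔 = WF.qform v L` the unnormalised energy form,
`(n_k+1)² ≤ b·((1+η)(𝓔[a†ψ] − T(n_k+1)) + η(n_k+1))`. For `T = E₀(m+3)` this is the landed block `hchanP` of
`KLS.klsMomentFor` (the regularised susceptibility `SuscPlus` tested at `Φ = a†ψ/‖a†ψ‖`). [cite: KLS1988JSP, (12)] -/
def ChanPlus (v : ℝ → ℝ≥0∞) (m : ℕ) (L : ℝ) (n : Fin 3 → ℤ) (T b : ℝ) : Prop :=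
  ∀ η : ℝ, 0 < η → ∃ δ : ℝ≥0∞, 0 < δ ∧ ∀ Ψ : PeriodicTrialState (m + 2) L, NearMinAt v δ Ψ →
    let nk : ℝ := (cellOccupation (m + 2) L (planeWaveMode L n) Ψ.ψ).toReal
    let qC : ℝ := (WF.qform v L (modeCr (planeWaveMode L n) Ψ.ψ)).toReal
    (nk + 1) ^ 2 ≤ b * ((1 + η) * (qC - T * (nk + 1)) + η * (nk + 1))

/-- **Hole channel (`−`) KLS inequality at near-minimisers of `H_{m+2}`, threshold `T`, bound `b`**: for every `η > 0` there
is `δ > 0` such that every `δ`-near-minimiser `Ψ` obeys, with `a = a(φ_n)`, `‖aψ‖² = n_k`,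
`n_k² ≤ b·((1+η)(𝓔[aψ] − T·n_k) + η·n_k)`. For `T = E₀(m+1)` this is the landed block `hchanM` of `KLS.klsMomentFor`
(`SuscMinus` at the pair `(m+1, m+2)` tested at `aψ/‖aψ‖`). [cite: KLS1988JSP, (12)] -/
def ChanMinus (v : ℝ → ℝ≥0∞) (m : ℕ) (L : ℝ) (n : Fin 3 → ℤ) (T b : ℝ) : Prop :=
  ∀ η : ℝ, 0 < η → ∃ δ : ℝ≥0∞, 0 < δ ∧ ∀ Ψ : PeriodicTrialState (m + 2) L, NearMinAt v δ Ψ →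
    let nk : ℝ := (cellOccupation (m + 2) L (planeWaveMode L n) Ψ.ψ).toReal
    let qA : ℝ := (WF.qform v L (modeAn L (planeWaveMode L n) Ψ.ψ)).toReal
    nk ^ 2 ≤ b * ((1 + η) * (qA - T * nk) + η * nk)

/-- **The floating two-channel bound for ONE potential with data `(K, ρ₀, C)`**, read along the thermodynamic boxes
`L = L_N(ρ) = (N/ρ)^{1/3}`, `N = m + 2`: for every slack `ε > 0` and density `ρ < ρ₀`, eventually in `N`, for every mode
`0 < 2π‖n‖_∞/L ≤ K` there are `μ₊ ≥ 0` and `μ₋ ≤ μ₊ + ε√(ρa)/L` (`a` the scattering length) such that BOTH channel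
inequalities hold at sector `N` with bound `b = CL²/‖n‖²_∞` against the thresholds `E₀(N) + μ₊` (particle) and
`E₀(N) − μ₋` (hole). With `μ₊ := E₀(N+1) − E₀(N)`, `μ₋ := E₀(N) − E₀(N−1)` this is the v6 input (two-channel
susceptibility ∧ midpoint near-convexity, `PooledToFloating`); in general the thresholds float by a common chemical
potential and no convexity of `N ↦ E₀(N, L)` is asked. A statement of the proof plan, not a result in print. -/
def FloatingFor (v : ℝ → ℝ≥0∞) (K ρ₀ C : ℝ) : Prop :=
  ∀ ε : ℝ, 0 < ε → ∀ ρ : ℝ, 0 < ρ → ρ < ρ₀ → ∀ᶠ m : ℕ in atTop,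
    ∀ n : Fin 3 → ℤ, n ≠ 0 → 2 * Real.pi / sideLength ρ (m + 2) * ‖(fun j => (n j : ℝ))‖ ≤ K →
      ∃ μp μm : ℝ, 0 ≤ μp ∧
        μm ≤ μp + ε * Real.sqrt (ρ * (scatteringLength v).toReal) / sideLength ρ (m + 2) ∧
        ChanPlus v m (sideLength ρ (m + 2)) n
            ((periodicGroundStateEnergy v (m + 2) (sideLength ρ (m + 2))).toReal + μp)
            (C * sideLength ρ (m + 2) ^ 2 / ‖(fun j => (n j : ℝ))‖ ^ 2) ∧
          ChanMinus v m (sideLength ρ (m + 2)) n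
            ((periodicGroundStateEnergy v (m + 2) (sideLength ρ (m + 2))).toReal - μm)
            (C * sideLength ρ (m + 2) ^ 2 / ‖(fun j => (n j : ℝ))‖ ^ 2)

/-! ## §2 Statements of the v7 stubs -/

/-- **Stub S1' statement — the floating two-channel bound (POOLED-NEW; open-problem strength; the load of v7)**: every
integrable admissible `v` admits data `K, ρ₀, C > 0` with `FloatingFor v K ρ₀ C`. Implied by stmt-12620 ∧ stmt-9094
(`floatingTwoChannel_of_pooled`); implies the integrable half of the crux (`integrableHalf_of_floating`), hence torus
TL-BEC for integrable `v`. Heuristic status: true at Bogoliubov level with the room of Gaussian domination itself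
(`b(k) = (ε_k + gρ)/(ε_k(ε_k + 2gρ)) ≤ 1/ε_k`, thresholds shifted by at most half a phonon gap), free-gas instance
`μ₊ = μ₋ = 0`, `C ≥ 1/(4π²)`. A statement of the proof plan, not a result in print. -/
def FloatingTwoChannel : Prop :=
  ∀ v : ℝ → ℝ≥0∞, IsRepulsiveFiniteRange v → (∫⁻ x : Space, v ‖x‖) ≠ ⊤ →
    ∃ K : ℝ, 0 < K ∧ ∃ ρ₀ : ℝ, 0 < ρ₀ ∧ ∃ C : ℝ, 0 < C ∧ FloatingFor v K ρ₀ C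

/-- **The KLS moment inequality with FREE thresholds at fixed `(N, L) = (m+2, L)` for ONE potential**: if the particle
channel holds against `Tp` and the hole channel against `Tm` (both with bound `b ≥ 0`, mode `n ≠ 0`), then for every
`η > 0` there is `δ > 0` such that every `δ`-near-minimiser `Ψ` of `H_N` obeys, with `y = 2n_k + 1`,
`y² ≤ 2b·[(1+η)·(|2πn/L|² + 2N‖v‖₁/L³ + E₀(N)·y − Tm·n_k − Tp·(n_k+1)) + η·(y+1)]`. For `Tp = E₀(N+1)`,
`Tm = E₀(N−1)` this is `KLSMomentFor v` (p138298); the proof is that proof with the channel blocks replaced by the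
hypotheses (`WF.wagnerFeynman_form_le`, `WF.abs_formRe_sub_le`, `KLS.real_core`, `KLS.exists_slack`).
[cite: KLS1988JSP, (12)–(14); Wagner1966, §2] -/
def KLSMomentForT (v : ℝ → ℝ≥0∞) : Prop :=
  ∀ (m : ℕ) (L : ℝ), 0 < L → periodicGroundStateEnergy v (m + 2) L ≠ ⊤ →
    ∀ n : Fin 3 → ℤ, n ≠ 0 → ∀ b : ℝ, 0 ≤ b → ∀ Tp Tm : ℝ, ChanPlus v m L n Tp b → ChanMinus v m L n Tm b →
      ∀ η : ℝ, 0 < η → ∃ δ : ℝ≥0∞, 0 < δ ∧ ∀ Ψ : PeriodicTrialState (m + 2) L, NearMinAt v δ Ψ →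
        let nk : ℝ := (cellOccupation (m + 2) L (planeWaveMode L n) Ψ.ψ).toReal
        (2 * nk + 1) ^ 2 ≤
          2 * b * ((1 + η) * (‖latticeVec (2 * Real.pi / L) n‖ ^ 2 +
              2 * ((m : ℝ) + 2) * (∫⁻ x : Space, v ‖x‖).toReal / L ^ 3 +
              (periodicGroundStateEnergy v (m + 2) L).toReal * (2 * nk + 1) - Tm * nk - Tp * (nk + 1)) +
            η * (2 * nk + 2))

/-- **Stub S4' statement**: `KLSMomentForT v` for every integrable admissible `v` (L in Lean, no open mathematics). -/
def KLSNearMinimiserT : Prop :=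
  ∀ v : ℝ → ℝ≥0∞, IsRepulsiveFiniteRange v → (∫⁻ x : Space, v ‖x‖) ≠ ⊤ → KLSMomentForT v

/-- **Stub S5' statement — window arithmetic and the scalar endgame, floating thresholds**: for an integrable admissible
`v`, `FloatingFor v K ρ₀ C` and the free-threshold moment inequality give the crux for `v`. Plan = the landed S5
(p138491) with the convexity extraction replaced by the hypothesis: fix `κ > 0`, `ρ₀' := min (ρ₀/2) ((K/(2πκ))²)`,
constant `C√a + 2κ + √((12π²C+1)κ² + 2C‖v‖₁)`; along `L = L_N`, eventually in `N = m+2`, for each window mode take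
`(μ₊, μ₋)` from `FloatingFor` (at `ε = 1`), the slack `δ(n)` from `KLSMomentForT` at `Tp := e0 + μ₊`, `Tm := e0 − μ₋`,
`η_n := min 1 (‖n‖²/(CL²))`, the least slack over the finite box (`Negative.inWindow_mem_box`), and conclude by
`WindowArith.nk_le` with `e3 := e0 + μ₊`, `e1 := e0 − μ₋` (`hmono : e0 ≤ e0 + μ₊`, `hconv : 2e0 ≤ (e0+μ₊) + (e0−μ₋) + e`).
A statement of the proof plan, not a result in print. -/
def WindowAssemblyT : Prop :=
  ∀ v : ℝ → ℝ≥0∞, IsRepulsiveFiniteRange v → (∫⁻ x : Space, v ‖x‖) ≠ ⊤ →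
    ∀ K ρ₀ C : ℝ, 0 < K → 0 < ρ₀ → 0 < C → FloatingFor v K ρ₀ C → KLSMomentForT v → IRBoundFor v

/-- **Stub S8 statement — the bridge from the v6 inputs**: for an integrable admissible `v`, the two-channel
susceptibility bound with data `(K, ρ₀, C)` and midpoint near-convexity give `FloatingFor v K ρ₀' C` for some `ρ₀' > 0`
(plan: `ρ₀' := min (ρ₀/2) ρ₁`; along `L = L_N`, eventually in `N = m+2`, `SuscPlus` at `N` tested at `a†ψ/‖a†ψ‖` and
`SuscMinus` at `N−1` tested at `aψ/‖aψ‖` — the blocks `hchanP`, `hchanM` of p138298 — give `ChanPlus … (e3) b` and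
`ChanMinus … (e1) b`; put `μ₊ := e3 − e0 ≥ 0` (monotonicity `WF.periodicGroundStateEnergy_le_succ`) and
`μ₋ := e0 − e1 ≤ μ₊ + ε√(ρa)/L` (convexity at `(N, L_N)`, as `hconvR` of p138491)). Provable now. -/
def PooledToFloating : Prop :=
  ∀ v : ℝ → ℝ≥0∞, IsRepulsiveFiniteRange v → (∫⁻ x : Space, v ‖x‖) ≠ ⊤ →
    ∀ K ρ₀ C : ℝ, 0 < K → 0 < ρ₀ → 0 < C →
      TwoChannelSusceptibility v K ρ₀ C → ConvexityFor v → ∃ ρ₀' : ℝ, 0 < ρ₀' ∧ FloatingFor v K ρ₀' C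

/-! ## §3 Sorry-free glue -/

/-- Lowering the threshold weakens the particle-channel inequality (`b ≥ 0`). [folklore] -/
theorem chanPlus_antitone {v : ℝ → ℝ≥0∞} {m : ℕ} {L : ℝ} {n : Fin 3 → ℤ} {T T' b : ℝ} (hb : 0 ≤ b)
    (hT : T' ≤ T) (h : ChanPlus v m L n T b) : ChanPlus v m L n T' b := by
  intro η hη
  obtain ⟨δ, hδ, hΨ⟩ := h η hη
  refine ⟨δ, hδ, fun Ψ hnear => ?_⟩
  have key := hΨ Ψ hnear
  simp only at key ⊢
  have hnk : 0 ≤ (cellOccupation (m + 2) L (planeWaveMode L n) Ψ.ψ).toReal + 1 := by positivity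
  have hmono : T' * ((cellOccupation (m + 2) L (planeWaveMode L n) Ψ.ψ).toReal + 1) ≤
      T * ((cellOccupation (m + 2) L (planeWaveMode L n) Ψ.ψ).toReal + 1) :=
    mul_le_mul_of_nonneg_right hT hnk
  have h1η : 0 ≤ 1 + η := by linarith
  nlinarith [mul_le_mul_of_nonneg_left (mul_le_mul_of_nonneg_left (sub_le_sub_left hmono
    ((WF.qform v L (modeCr (planeWaveMode L n) Ψ.ψ)).toReal)) h1η) hb]

/-- Lowering the threshold weakens the hole-channel inequality (`b ≥ 0`). [folklore] -/
theorem chanMinus_antitone {v : ℝ → ℝ≥0∞} {m : ℕ} {L : ℝ} {n : Fin 3 → ℤ} {T T' b : ℝ} (hb : 0 ≤ b)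
    (hT : T' ≤ T) (h : ChanMinus v m L n T b) : ChanMinus v m L n T' b := by
  intro η hη
  obtain ⟨δ, hδ, hΨ⟩ := h η hη
  refine ⟨δ, hδ, fun Ψ hnear => ?_⟩
  have key := hΨ Ψ hnear
  simp only at key ⊢
  have hnk : 0 ≤ (cellOccupation (m + 2) L (planeWaveMode L n) Ψ.ψ).toReal := ENNReal.toReal_nonneg
  have hmono : T' * (cellOccupation (m + 2) L (planeWaveMode L n) Ψ.ψ).toReal ≤
      T * (cellOccupation (m + 2) L (planeWaveMode L n) Ψ.ψ).toReal :=
    mul_le_mul_of_nonneg_right hT hnk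
  have h1η : 0 ≤ 1 + η := by linarith
  nlinarith [mul_le_mul_of_nonneg_left (mul_le_mul_of_nonneg_left (sub_le_sub_left hmono
    ((WF.qform v L (modeAn L (planeWaveMode L n) Ψ.ψ)).toReal)) h1η) hb]

/-- **The integrable half of the crux from S1', S4', S5'.** [folklore] -/
theorem integrableHalf_of_floating (h1 : FloatingTwoChannel) (h4 : KLSNearMinimiserT) (h5 : WindowAssemblyT) :
    ∀ v : ℝ → ℝ≥0∞, IsRepulsiveFiniteRange v → (∫⁻ x : Space, v ‖x‖) ≠ ⊤ → IRBoundFor v := by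
  intro v hv hint
  obtain ⟨K, hK, ρ₀, hρ₀, C, hC, hF⟩ := h1 v hv hint
  exact h5 v hv hint K ρ₀ C hK hρ₀ hC hF (h4 v hv hint)

/-- **The v6 inputs still suffice**: Gaussian domination (stmt-12620), midpoint near-convexity (stmt-9094), the landed
Kato step (`KatoSusceptibility`, p138476) and the bridge S8 give the floating two-channel bound S1'. [folklore] -/
theorem floatingTwoChannel_of_pooled (hGD : GaussianDomination) (hC : EnergyConvexityWindow)
    (h3 : KatoSusceptibility) (h8 : PooledToFloating) : FloatingTwoChannel := by
  intro v hv hint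
  obtain ⟨K, hK, ρ₀, hρ₀, C, hCpos, hGDv⟩ := gaussianDomination_iff.1 hGD v hv hint
  obtain ⟨ρ₀', hρ₀', hF⟩ := h8 v hv hint K ρ₀ C hK hρ₀ hCpos (h3 v hv hint K ρ₀ C hCpos hGDv)
    (energyConvexityWindow_iff.1 hC v hv)
  exact ⟨K, hK, ρ₀', hρ₀', C, hCpos, hF⟩

/-- **Registered by-product `stub_integrableHalfOfFloating` of the crux ledger** (line `two-sector-gd-transfer`, v7):
S1' ∧ S4' ∧ S5' give `IRBoundFor v` for every INTEGRABLE admissible `v`. [folklore] -/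
theorem stub_integrableHalfOfFloating :
    FloatingTwoChannel → KLSNearMinimiserT → WindowAssemblyT →
      ∀ v : ℝ → ℝ≥0∞, IsRepulsiveFiniteRange v → (∫⁻ x : Space, v ‖x‖) ≠ ⊤ → IRBoundFor v :=
  integrableHalf_of_floating

end Summit.AtomisticToContinuum.BoseEinsteinCondensation.Cruxes.PeriodicIRBound.TwoSectorGdTransfer

end
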